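import Literature.NumberTheory.Automorphic.UnitaryGroupBorelRingModulus                    -- ★ `HeisRing.torusConj`, `continuous_torusConj`, `distribHaarChar_torus` (`‖d₂‖ = ‖d₀‖⁻¹`)
import Summits.HodgeConjecture.HodgeConjecture.Theorems.F0P3cStCharTSHeisenbergAnnulusSlice   -- ★ B3 (this seat): `heisZ_heisX_heisY` (`z(u) = u₀₂`), the annulus slice on `heisHaar`
import HarnessLib

/-!
# Road «KEYS3-ANALYTIC» (MEMO v3 §5 (b)): torus conjugation on `N` moves the norm balls of the `z`-entry; annulus differences of set integrals

Sub-problem `HodgeConjecture/HodgeConjecture`, crux H413 `hKeysRed3` (item stmt-HodgeConjecture-24833), brick B6b of the road (count-neutral helper, `--supports`).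
THEOREMS ONLY, ring-generic (§1) ∕ measure-generic (§2); no definition, no instance, no notation, no `sorry`.

§1 (`R` commutative, `σ`, `J`, the Heisenberg radical `N = unipotentU σ J` and torus `T = torusU σ J` of ★ `UnitaryGroupHeisenbergRing`): for `t = diag(d) ∈ T`
the conjugation `c_t : u ↦ t⁻¹ u t` (★ `HeisRing.torusConj`) has entries `(c_t u)_{ij} = d_i⁻¹ u_{ij} d_j` (`entry_torusConj`), is a bijection with inverse
`c_{t⁻¹}` (`torusConj_inv_apply`, `torusConj_apply_inv`, `image_torusConj_eq_preimage`) and a measurable embedding (`measurableEmbedding_torusConj`), and for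
every `nrm : R → ℝ≥0` with `nrm (u b) = ‖u‖_R nrm b` it maps the ball `{u : nrm (u₀₂) ≤ A}` onto `{u : nrm (u₀₂) ≤ A ∕ ‖d₀‖_R²}` (`image_torusConj_normBall`;
★ `distribHaarChar_torus`: `‖d₂‖ = ‖d₀‖⁻¹`); the ball is compact as soon as the chart sub-level set `{(x, y) : nrm (heisZ x y) ≤ A}` is (`isCompact_normBall_of_chart`,
★ DICT `isCompact_setOf_prod_normAbs_heisZ_le` supplies the hypothesis at a non-split CM place).
§2 (any measure space `Γ`, `ν : Γ → ℝ`, `F : Γ → W`): `∫_{ν ≤ B} F − ∫_{ν ≤ A} F = −∫_{B < ν ≤ A} F` for `B ≤ A` and `= ∫_{A < ν ≤ B} F` for `A ≤ B`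
(`setIntegral_ball_sub_setIntegral_ball_of_le` ∕ `_of_ge`), and `∫_{z ∈ S} F = ∫ (S.indicator Ψ) ∘ z` when `F = Ψ ∘ z` on `z⁻¹' …` (`setIntegral_preimage_eq_integral_indicator_comp`).
These are the set-theoretic steps between ★ B5 `F0P3cStCharTSCellFunAnnulusFormula.integral_cellFun_sub_eq_smul_sub_setIntegral` (`b • (∫_{c(K)} F − ∫_K F)`) and
★ B3 `F0P3cStCharTSHeisenbergAnnulusSlice.integral_annulus_heisZ_eq_zero_of_eigen_unit` (the annulus `{A∕Q² < nrm z ≤ A}`).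
Sources: [Rogawski1990, §1.10 p. 9] (`N`, `T`, `t⁻¹ u t` in coordinates); [Casselman1995, §6.3]; [Keys1984, §7 Thm. (1)].
-/

set_option autoImplicit false
set_option linter.dupNamespace false

noncomputable section

open MeasureTheory Set
open scoped NNReal ENNReal

namespace Summit.HodgeConjecture.HodgeConjecture.Cruxes.H413.F0P3cStCharTSKeys3TorusConjBall

open Literature.NumberTheory.Automorphic Literature.NumberTheory.Automorphic.UnitaryGroup
  Literature.NumberTheory.Automorphic.UnitaryGroup.HeisRing

/-! ## §1 Torus conjugation on `N`: entries, bijectivity, norm balls -/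

section Torus

variable {R : Type*} [CommRing R] (σ : R →+* R) {J : Matrix (Fin 3) (Fin 3) R}

/-- **`(t⁻¹ u t)_{ij} = d_i⁻¹ u_{ij} d_j`** for `t = diag(d) ∈ T`, `u ∈ N`. [cite: Rogawski1990, §1.10 p. 9] -/
theorem entry_torusConj (t : ↥(torusU σ J)) {d : Fin 3 → Rˣ} (hd : glDiagonal 3 R d = ((t : ↥(unitaryGroupOfForm σ J)) : GL (Fin 3) R))
    (u : ↥(unipotentU σ J)) (i j : Fin 3) :
    ((((torusConj σ t u : ↥(unipotentU σ J)) : ↥(unitaryGroupOfForm σ J)) : GL (Fin 3) R) : Matrix (Fin 3) (Fin 3) R) i j =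
      (((d i)⁻¹ : Rˣ) : R) * ((((u : ↥(unitaryGroupOfForm σ J)) : GL (Fin 3) R) : Matrix (Fin 3) (Fin 3) R) i j) * (d j : R) := by
  have ht : (((t : ↥(unitaryGroupOfForm σ J)) : GL (Fin 3) R) : Matrix (Fin 3) (Fin 3) R) = Matrix.diagonal fun k => (d k : R) := by
    rw [← hd, coe_glDiagonal]
  have hti : ((((t : ↥(unitaryGroupOfForm σ J))⁻¹ : ↥(unitaryGroupOfForm σ J)) : GL (Fin 3) R) : Matrix (Fin 3) (Fin 3) R) =
      Matrix.diagonal fun k => (((d k)⁻¹ : Rˣ) : R) := by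
    rw [Subgroup.coe_inv, ← hd, ← map_inv, coe_glDiagonal]; rfl
  rw [coe_torusConj, Subgroup.coe_mul, Subgroup.coe_mul, Units.val_mul, Units.val_mul, hti, ht, Matrix.mul_diagonal, Matrix.diagonal_mul]

/-- `c_{t⁻¹} (c_t u) = u`. [cite: Rogawski1990, §1.10 p. 9] -/
theorem torusConj_inv_apply (t : ↥(torusU σ J)) (u : ↥(unipotentU σ J)) : torusConj σ t⁻¹ (torusConj σ t u) = u := by
  apply Subtype.ext
  rw [coe_torusConj, coe_torusConj, Subgroup.coe_inv, inv_inv]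
  group

/-- `c_t (c_{t⁻¹} u) = u`. [cite: Rogawski1990, §1.10 p. 9] -/
theorem torusConj_apply_inv (t : ↥(torusU σ J)) (u : ↥(unipotentU σ J)) : torusConj σ t (torusConj σ t⁻¹ u) = u := by
  apply Subtype.ext
  rw [coe_torusConj, coe_torusConj, Subgroup.coe_inv, inv_inv]
  group

/-- `c_t(S) = c_{t⁻¹}⁻¹(S)`: images under torus conjugation are preimages under the inverse conjugation. [cite: Rogawski1990, §1.10 p. 9] -/
theorem image_torusConj_eq_preimage (t : ↥(torusU σ J)) (S : Set ↥(unipotentU σ J)) : torusConj σ t '' S = torusConj σ t⁻¹ ⁻¹' S :=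
  congrFun (Set.image_eq_preimage_of_inverse (torusConj_inv_apply σ t) (torusConj_apply_inv σ t)) S

/-- `diag(d⁻¹) = t⁻¹`. [cite: Rogawski1990, §1.10 p. 9] -/
theorem glDiagonal_inv_eq (t : ↥(torusU σ J)) {d : Fin 3 → Rˣ} (hd : glDiagonal 3 R d = ((t : ↥(unitaryGroupOfForm σ J)) : GL (Fin 3) R)) :
    glDiagonal 3 R d⁻¹ = (((t⁻¹ : ↥(torusU σ J)) : ↥(unitaryGroupOfForm σ J)) : GL (Fin 3) R) := by
  rw [map_inv, hd, Subgroup.coe_inv, Subgroup.coe_inv]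

/-- **`(c_{t⁻¹} u)₀₂ = (d₀ d₂⁻¹) · u₀₂`**. [cite: Rogawski1990, §1.10 p. 9] -/
theorem entry_torusConj_inv_zero_two (t : ↥(torusU σ J)) {d : Fin 3 → Rˣ} (hd : glDiagonal 3 R d = ((t : ↥(unitaryGroupOfForm σ J)) : GL (Fin 3) R))
    (u : ↥(unipotentU σ J)) :
    ((((torusConj σ t⁻¹ u : ↥(unipotentU σ J)) : ↥(unitaryGroupOfForm σ J)) : GL (Fin 3) R) : Matrix (Fin 3) (Fin 3) R) 0 2 =
      ((d 0 * (d 2)⁻¹ : Rˣ) : R) * ((((u : ↥(unitaryGroupOfForm σ J)) : GL (Fin 3) R) : Matrix (Fin 3) (Fin 3) R) 0 2) := by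
  rw [entry_torusConj σ t⁻¹ (glDiagonal_inv_eq σ t hd) u 0 2, Pi.inv_apply, Pi.inv_apply, inv_inv, Units.val_mul]
  ring

variable [TopologicalSpace R] [IsTopologicalRing R]

/-- Torus conjugation is a measurable embedding of `N` (a homeomorphism with inverse `c_{t⁻¹}`, ★ `continuous_torusConj`). [cite: Rogawski1990, §1.10 p. 9] -/
theorem measurableEmbedding_torusConj [MeasurableSpace ↥(unipotentU σ J)] [BorelSpace ↥(unipotentU σ J)] (t : ↥(torusU σ J)) :
    MeasurableEmbedding (torusConj σ t : ↥(unipotentU σ J) → ↥(unipotentU σ J)) :=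
  (Homeomorph.mk ⟨torusConj σ t, torusConj σ t⁻¹, torusConj_inv_apply σ t, torusConj_apply_inv σ t⟩ (continuous_torusConj σ t) (continuous_torusConj σ t⁻¹)).measurableEmbedding

variable [LocallyCompactSpace R] [MeasurableSpace R] [BorelSpace R] (hσ : ∀ x, σ (σ x) = x) (hσc : Continuous σ) (hJ : J = (StdForm.antidiagonal 3).over R)
  {nrm : R → ℝ≥0} (hmul : ∀ (u : Rˣ) (b : R), nrm ((u : R) * b) = distribHaarChar R u * nrm b)

include hσ hσc hJ hmul in
/-- **`c_t` maps the ball `{u : nrm (u₀₂) ≤ A}` onto `{u : nrm (u₀₂) ≤ A ∕ ‖d₀‖_R²}`** (`(c_{t⁻¹} u)₀₂ = d₀ d₂⁻¹ u₀₂`, `‖d₀ d₂⁻¹‖ = ‖d₀‖²` by ★ `distribHaarChar_torus`).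
For `‖d₀‖ > 1` the image is the smaller ball and the difference is the annulus `{A∕‖d₀‖² < nrm (u₀₂) ≤ A}` of ★ B3. [cite: Rogawski1990, §1.10 p. 9] [cite: Casselman1995, §6.3] -/
theorem image_torusConj_normBall (t : ↥(torusU σ J)) {d : Fin 3 → Rˣ} (hd : glDiagonal 3 R d = ((t : ↥(unitaryGroupOfForm σ J)) : GL (Fin 3) R)) (A : ℝ) :
    torusConj σ t '' {u : ↥(unipotentU σ J) | (nrm ((((u : ↥(unitaryGroupOfForm σ J)) : GL (Fin 3) R) : Matrix (Fin 3) (Fin 3) R) 0 2) : ℝ) ≤ A} =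
      {u : ↥(unipotentU σ J) | (nrm ((((u : ↥(unitaryGroupOfForm σ J)) : GL (Fin 3) R) : Matrix (Fin 3) (Fin 3) R) 0 2) : ℝ) ≤
        A / ((distribHaarChar R (d 0) : ℝ) ^ 2)} := by
  have hQ : (0 : ℝ) < (distribHaarChar R (d 0) : ℝ) := NNReal.coe_pos.2 distribHaarChar_pos
  have hmod : distribHaarChar R (d 0 * (d 2)⁻¹) = distribHaarChar R (d 0) * distribHaarChar R (d 0) := by
    rw [map_mul, map_inv, (distribHaarChar_torus σ hσ hσc hJ t hd).2, inv_inv]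
  ext u
  rw [image_torusConj_eq_preimage, mem_preimage, mem_setOf_eq, mem_setOf_eq, entry_torusConj_inv_zero_two σ t hd u, hmul, hmod, NNReal.coe_mul,
    NNReal.coe_mul, le_div_iff₀ (pow_pos hQ 2), sq, mul_comm (distribHaarChar R (d 0) * distribHaarChar R (d 0) : ℝ)]

omit [LocallyCompactSpace R] [MeasurableSpace R] [BorelSpace R] in
include hσ hσc hJ in
/-- **The ball `{u ∈ N : nrm (u₀₂) ≤ A}` is compact when the chart sub-level set `{(x, y) : nrm (heisZ x y) ≤ A}` is** (it is its image under the chart homeomorphism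
★ `heisHomeomorph`, since `z(u(x, y)) = heisZ x y`, ★ `heisZ_heisX_heisY`). [cite: Rogawski1990, §1.10 p. 9] -/
theorem isCompact_normBall_of_chart [Invertible (2 : R)] {A : ℝ} (hcpt : IsCompact {p : R × skewPart σ | (nrm (heisZ σ p.1 (p.2 : R)) : ℝ) ≤ A}) :
    IsCompact {u : ↥(unipotentU σ J) | (nrm ((((u : ↥(unitaryGroupOfForm σ J)) : GL (Fin 3) R) : Matrix (Fin 3) (Fin 3) R) 0 2) : ℝ) ≤ A} := by
  have hset : {u : ↥(unipotentU σ J) | (nrm ((((u : ↥(unitaryGroupOfForm σ J)) : GL (Fin 3) R) : Matrix (Fin 3) (Fin 3) R) 0 2) : ℝ) ≤ A} =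
      heisHomeomorph σ hσ hσc hJ '' {p : R × skewPart σ | (nrm (heisZ σ p.1 (p.2 : R)) : ℝ) ≤ A} := by
    refine Set.ext fun u => ⟨fun hu => ⟨(heisHomeomorph σ hσ hσc hJ).symm u, ?_, (heisHomeomorph σ hσ hσc hJ).apply_symm_apply u⟩, ?_⟩
    · rw [mem_setOf_eq, heisHomeomorph_symm_apply, F0P3cStCharTSHeisenbergAnnulusSlice.heisZ_heisX_heisY σ hσ hJ u]
      exact hu
    · rintro ⟨p, hp, rfl⟩
      rw [mem_setOf_eq, heisHomeomorph_apply, ← F0P3cStCharTSHeisenbergAnnulusSlice.heisZ_heisX_heisY σ hσ hJ, heisX_heisElt, heisY_heisElt]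
      exact hp
  rw [hset]
  exact hcpt.image (heisHomeomorph σ hσ hσc hJ).continuous

end Torus

/-! ## §2 Annulus differences of set integrals over sub-level sets -/

section Annulus

variable {Γ : Type*} [MeasurableSpace Γ] (μ : Measure Γ) {W : Type*} [NormedAddCommGroup W] [NormedSpace ℝ W] {ν : Γ → ℝ} (hν : Measurable ν) (F : Γ → W)

omit [MeasurableSpace Γ] in
/-- `{ν ≤ A} \ {ν ≤ B} = ν⁻¹' (B, A]`. [cite: Casselman1995, §6.3] -/
theorem setOf_le_diff_setOf_le (ν : Γ → ℝ) (A B : ℝ) : {γ | ν γ ≤ A} \ {γ | ν γ ≤ B} = ν ⁻¹' Set.Ioc B A := by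
  ext γ
  simp only [mem_sdiff, mem_setOf_eq, not_le, mem_preimage, mem_Ioc]
  exact and_comm

include hν in
/-- **`∫_{ν ≤ B} F − ∫_{ν ≤ A} F = −∫_{B < ν ≤ A} F`** for `B ≤ A` and `F` integrable on `{ν ≤ A}`. [cite: Casselman1995, §6.3] -/
theorem setIntegral_ball_sub_setIntegral_ball_of_le {A B : ℝ} (hBA : B ≤ A) (hF : IntegrableOn F {γ | ν γ ≤ A} μ) :
    ∫ γ in {γ | ν γ ≤ B}, F γ ∂μ - ∫ γ in {γ | ν γ ≤ A}, F γ ∂μ = -∫ γ in ν ⁻¹' Set.Ioc B A, F γ ∂μ := by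
  have hsub : {γ | ν γ ≤ B} ⊆ {γ | ν γ ≤ A} := fun γ (hγ : ν γ ≤ B) => le_trans hγ hBA
  rw [← setOf_le_diff_setOf_le ν A B, setIntegral_sdiff (measurableSet_le hν measurable_const) hF hsub, neg_sub]

include hν in
/-- **`∫_{ν ≤ B} F − ∫_{ν ≤ A} F = ∫_{A < ν ≤ B} F`** for `A ≤ B` and `F` integrable on `{ν ≤ B}`. [cite: Casselman1995, §6.3] -/
theorem setIntegral_ball_sub_setIntegral_ball_of_ge {A B : ℝ} (hAB : A ≤ B) (hF : IntegrableOn F {γ | ν γ ≤ B} μ) :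
    ∫ γ in {γ | ν γ ≤ B}, F γ ∂μ - ∫ γ in {γ | ν γ ≤ A}, F γ ∂μ = ∫ γ in ν ⁻¹' Set.Ioc A B, F γ ∂μ := by
  have hsub : {γ | ν γ ≤ A} ⊆ {γ | ν γ ≤ B} := fun γ (hγ : ν γ ≤ A) => le_trans hγ hAB
  rw [← setOf_le_diff_setOf_le ν B A, setIntegral_sdiff (measurableSet_le hν measurable_const) hF hsub]

/-- **`∫_{z⁻¹'S} F = ∫ (S.indicator Ψ) ∘ z`** when `F = Ψ ∘ z` on `z⁻¹' S` (`S` measurable, `z` measurable). [cite: Casselman1995, §6.3] -/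
theorem setIntegral_preimage_eq_integral_indicator_comp {X : Type*} [MeasurableSpace X] {z : Γ → X} (hz : Measurable z) {S : Set X}
    (hS : MeasurableSet S) (Ψ : X → W) (hF : ∀ γ, z γ ∈ S → F γ = Ψ (z γ)) :
    ∫ γ in z ⁻¹' S, F γ ∂μ = ∫ γ, S.indicator Ψ (z γ) ∂μ := by
  rw [← integral_indicator (hz hS), Set.indicator_congr (s := z ⁻¹' S) (f := F) (g := Ψ ∘ z) (fun γ hγ => hF γ hγ)]
  refine integral_congr_ae (Filter.Eventually.of_forall fun γ => ?_)
  exact Set.indicator_comp_right z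

/-- `∫ (S.indicator (V • Ψ)) ∘ z = V • ∫ (S.indicator Ψ) ∘ z`. [cite: Casselman1995, §6.3] -/
theorem integral_indicator_const_smul_comp {X : Type*} {z : Γ → X} (S : Set X) {𝕜 : Type*} [RCLike 𝕜] [NormedSpace 𝕜 W] (V : 𝕜) (Ψ : X → W) :
    ∫ γ, S.indicator (fun x => V • Ψ x) (z γ) ∂μ = V • ∫ γ, S.indicator Ψ (z γ) ∂μ := by
  rw [← integral_smul]
  refine integral_congr_ae (Filter.Eventually.of_forall fun γ => ?_)
  exact Set.indicator_const_smul_apply S V Ψ (z γ)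

end Annulus

end Summit.HodgeConjecture.HodgeConjecture.Cruxes.H413.F0P3cStCharTSKeys3TorusConjBall

end
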